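import Mathlib.Analysis.Complex.Liouville
import Mathlib.Analysis.Complex.LocallyUniformLimit
import Mathlib.Analysis.Calculus.MeanValue
import Literature.Analysis.OperatorTheory.SesquilinearExtension
import HarnessLib

/-!
# Weakly holomorphic bounded families of operators are holomorphic

For a family `W : ℂ → (H →L[ℂ] H)` of bounded operators on a complex Hilbert space, uniformly
bounded on an open set `s`, holomorphy of all matrix coefficients `z ↦ ⟪a, W z b⟫` on `s` implies
holomorphy of `W` in operator norm (a special case of N. Dunford's theorem, *Uniformity in linear
spaces*, Trans. AMS 44 (1938), Thm. 76: weakly analytic vector functions are analytic; see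
Reed–Simon I, Thm. VI.4). We give the elementary Hilbert-space proof: Cauchy's estimate bounds the
second Taylor remainder of every matrix coefficient uniformly (`norm_sub_sub_mul_deriv_le`), the
first Taylor coefficients form a bounded sesquilinear form, and its Riesz operator
(`IsSesqForm.operator`) is the derivative (`differentiableOn_of_forall_differentiableOn_inner`).
We also record the density upgrades used to feed it: uniform limits of continuous/holomorphic
matrix coefficients over dense sets of vectors (`continuousOn_inner_of_dense`,
`differentiableOn_inner_of_dense`).

## References
* M. Reed, B. Simon, *Methods of Modern Mathematical Physics I* (1980), Thm. VI.4 (weak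
  analyticity implies norm analyticity). [ReedSimonI1980]
-/

noncomputable section

open Set Filter Metric Complex
open _root_.Topology
open scoped InnerProductSpace ComplexConjugate

namespace Literature.Analysis.OperatorTheory

/-! ## Scalar Taylor estimates from Cauchy's inequality -/

section Scalar

/-- **Cauchy's estimate on a smaller ball**: if `φ` is holomorphic on `ball z₀ r` with `‖φ‖ ≤ M`
there, then `‖φ'(c)‖ ≤ 2M/r` on `ball z₀ (r/2)`. [folklore] -/
theorem norm_deriv_le_of_forall_mem_ball {φ : ℂ → ℂ} {z₀ : ℂ} {r M : ℝ} (hr : 0 < r)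
    (hd : DifferentiableOn ℂ φ (ball z₀ r)) (hM : ∀ z ∈ ball z₀ r, ‖φ z‖ ≤ M)
    {c : ℂ} (hc : c ∈ ball z₀ (r / 2)) : ‖deriv φ c‖ ≤ 2 * M / r := by
  have hsub : closedBall c (r / 2) ⊆ ball z₀ r := by
    intro w hw
    rw [mem_closedBall] at hw
    rw [mem_ball] at hc ⊢
    calc dist w z₀ ≤ dist w c + dist c z₀ := dist_triangle _ _ _
      _ < r / 2 + r / 2 := add_lt_add_of_le_of_lt hw hc
      _ = r := by ring
  have hdc : DiffContOnCl ℂ φ (ball c (r / 2)) := by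
    refine ⟨hd.mono (ball_subset_closedBall.trans hsub), ?_⟩
    rw [closure_ball c (by positivity)]
    exact (hd.continuousOn).mono hsub
  have h := Complex.norm_deriv_le_of_forall_mem_sphere_norm_le (by positivity : 0 < r / 2) hdc
    (fun w hw => hM w (hsub (sphere_subset_closedBall hw)))
  calc ‖deriv φ c‖ ≤ M / (r / 2) := h
    _ = 2 * M / r := by field_simp

/-- **Second-order Taylor remainder from Cauchy's estimate**: for `φ` holomorphic and bounded by
`M` on `ball z₀ r`, `‖φ z − φ z₀ − (z − z₀) φ'(z₀)‖ ≤ (8M/r²) ‖z − z₀‖²` on `ball z₀ (r/4)`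
(Cauchy's inequality twice and the mean value inequality). [folklore] -/
theorem norm_sub_sub_mul_deriv_le {φ : ℂ → ℂ} {z₀ : ℂ} {r M : ℝ} (hr : 0 < r)
    (hd : DifferentiableOn ℂ φ (ball z₀ r)) (hM : ∀ z ∈ ball z₀ r, ‖φ z‖ ≤ M)
    {z : ℂ} (hz : z ∈ ball z₀ (r / 4)) :
    ‖φ z - φ z₀ - (z - z₀) * deriv φ z₀‖ ≤ 8 * M / r ^ 2 * ‖z - z₀‖ ^ 2 := by
  -- `φ'` is holomorphic on the ball and bounded by `2M/r` on the half ball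
  have hd' : DifferentiableOn ℂ (deriv φ) (ball z₀ r) :=
    ((hd.analyticOnNhd isOpen_ball).deriv).differentiableOn
  have hM' : ∀ w ∈ ball z₀ (r / 2), ‖deriv φ w‖ ≤ 2 * M / r := fun w hw =>
    norm_deriv_le_of_forall_mem_ball hr hd hM hw
  -- `φ''` is bounded by `8M/r²` on the quarter ball
  have hM'' : ∀ w ∈ ball z₀ (r / 4), ‖deriv (deriv φ) w‖ ≤ 8 * M / r ^ 2 := by
    intro w hw
    have hw' : w ∈ ball z₀ (r / 2 / 2) := by rw [show r / 2 / 2 = r / 4 by ring]; exact hw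
    have h := norm_deriv_le_of_forall_mem_ball (by positivity : 0 < r / 2)
      (hd'.mono (ball_subset_ball (by linarith))) hM' hw'
    calc ‖deriv (deriv φ) w‖ ≤ 2 * (2 * M / r) / (r / 2) := h
      _ = 8 * M / r ^ 2 := by field_simp; ring
  -- mean value inequality for `ψ w = φ w - φ z₀ - (w - z₀) φ'(z₀)` on `closedBall z₀ ‖z - z₀‖`
  set ρ : ℝ := dist z z₀ with hρ
  have hρr : ρ < r / 4 := mem_ball.1 hz
  have hsub : closedBall z₀ ρ ⊆ ball z₀ (r / 4) := closedBall_subset_ball hρr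
  have hsub' : ball z₀ (r / 4) ⊆ ball z₀ r := ball_subset_ball (by linarith)
  set ψ : ℂ → ℂ := fun w => φ w - φ z₀ - (w - z₀) * deriv φ z₀ with hψ
  have hψd : ∀ w ∈ ball z₀ (r / 4), HasDerivAt ψ (deriv φ w - deriv φ z₀) w := by
    intro w hw
    have h1 : HasDerivAt φ (deriv φ w) w :=
      (hd.differentiableAt (isOpen_ball.mem_nhds (hsub' hw))).hasDerivAt
    have h2 : HasDerivAt (fun w : ℂ => (w - z₀) * deriv φ z₀) (deriv φ z₀) w := by
      simpa using ((hasDerivAt_id w).sub_const z₀).mul_const (deriv φ z₀)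
    show HasDerivAt (fun w => φ w - φ z₀ - (w - z₀) * deriv φ z₀) _ w
    exact (h1.sub_const (φ z₀)).sub h2
  -- bound on `ψ'` on the small closed ball: `‖φ' w - φ' z₀‖ ≤ (8M/r²) ρ`
  have hψ' : ∀ w ∈ closedBall z₀ ρ, ‖deriv ψ w‖ ≤ 8 * M / r ^ 2 * ρ := by
    intro w hw
    rw [(hψd w (hsub hw)).deriv]
    have hmv := (convex_closedBall z₀ ρ).norm_image_sub_le_of_norm_deriv_le
      (f := deriv φ) (fun v hv => hd'.differentiableAt (isOpen_ball.mem_nhds (hsub' (hsub hv))))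
      (fun v hv => hM'' v (hsub hv)) (mem_closedBall_self (by positivity)) hw
    calc ‖deriv φ w - deriv φ z₀‖ ≤ 8 * M / r ^ 2 * ‖w - z₀‖ := hmv
      _ ≤ 8 * M / r ^ 2 * ρ := by
          have hM0 : 0 ≤ M := (norm_nonneg _).trans (hM z₀ (mem_ball_self hr))
          gcongr
          rwa [← dist_eq_norm, ← mem_closedBall]
  have hmv := (convex_closedBall z₀ ρ).norm_image_sub_le_of_norm_deriv_le (f := ψ)
    (fun v hv => (hψd v (hsub hv)).differentiableAt) hψ'
    (mem_closedBall_self (by positivity)) (mem_closedBall.2 le_rfl)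
  have hψ0 : ψ z₀ = 0 := by simp [hψ]
  rw [hψ0, sub_zero] at hmv
  calc ‖φ z - φ z₀ - (z - z₀) * deriv φ z₀‖ = ‖ψ z‖ := rfl
    _ ≤ 8 * M / r ^ 2 * ρ * ‖z - z₀‖ := hmv
    _ = 8 * M / r ^ 2 * ‖z - z₀‖ ^ 2 := by rw [hρ, dist_eq_norm]; ring

end Scalar

/-! ## Matrix coefficients over dense sets of vectors -/

section Dense

variable {H : Type*} [NormedAddCommGroup H] [InnerProductSpace ℂ H]

/-- The elementary estimate behind the density arguments:
`|⟪a, W b⟫ − ⟪u, W x⟫| ≤ C (‖a − u‖ ‖b‖ + ‖u‖ ‖b − x‖)` for `‖W‖ ≤ C`. [folklore] -/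
theorem norm_inner_apply_sub_inner_apply_le (W : H →L[ℂ] H) {C : ℝ} (hW : ‖W‖ ≤ C) (a b u x : H) :
    ‖⟪a, W b⟫_ℂ - ⟪u, W x⟫_ℂ‖ ≤ C * (‖a - u‖ * ‖b‖ + ‖u‖ * ‖b - x‖) := by
  have hC : 0 ≤ C := (norm_nonneg _).trans hW
  have h1 : ⟪a, W b⟫_ℂ - ⟪u, W x⟫_ℂ = ⟪a - u, W b⟫_ℂ + ⟪u, W (b - x)⟫_ℂ := by
    rw [inner_sub_left, map_sub, inner_sub_right]; ring
  rw [h1]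
  refine (norm_add_le _ _).trans ?_
  have h2 : ‖⟪a - u, W b⟫_ℂ‖ ≤ C * (‖a - u‖ * ‖b‖) :=
    (norm_inner_le_norm _ _).trans (by
      calc ‖a - u‖ * ‖W b‖ ≤ ‖a - u‖ * (C * ‖b‖) := by gcongr; exact W.le_of_opNorm_le hW b
        _ = C * (‖a - u‖ * ‖b‖) := by ring)
  have h3 : ‖⟪u, W (b - x)⟫_ℂ‖ ≤ C * (‖u‖ * ‖b - x‖) :=
    (norm_inner_le_norm _ _).trans (by
      calc ‖u‖ * ‖W (b - x)‖ ≤ ‖u‖ * (C * ‖b - x‖) := by gcongr; exact W.le_of_opNorm_le hW _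
        _ = C * (‖u‖ * ‖b - x‖) := by ring)
  linarith

/-- **Uniform approximation of matrix coefficients**: if `uₙ → a` and `xₙ → b` then
`z ↦ ⟪uₙ, W z xₙ⟫ → z ↦ ⟪a, W z b⟫` uniformly on any set where `‖W z‖ ≤ C`. [folklore] -/
theorem tendstoUniformlyOn_inner_apply {W : ℂ → H →L[ℂ] H} {s : Set ℂ} {C : ℝ}
    (hW : ∀ z ∈ s, ‖W z‖ ≤ C) {u x : ℕ → H} {a b : H} (hu : Tendsto u atTop (𝓝 a))
    (hx : Tendsto x atTop (𝓝 b)) :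
    TendstoUniformlyOn (fun n z => ⟪u n, W z (x n)⟫_ℂ) (fun z => ⟪a, W z b⟫_ℂ) atTop s := by
  have hC : ∀ z ∈ s, 0 ≤ C := fun z hz => (norm_nonneg _).trans (hW z hz)
  rw [Metric.tendstoUniformlyOn_iff]
  intro ε hε
  -- the bound `C (‖a - uₙ‖ ‖b‖ + ‖uₙ‖ ‖b - xₙ‖)` tends to `0`
  have hlim : Tendsto (fun n => |C| * (‖a - u n‖ * ‖b‖ + ‖u n‖ * ‖b - x n‖)) atTop (𝓝 0) := by
    have h1 : Tendsto (fun n => ‖a - u n‖) atTop (𝓝 0) := by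
      have := (tendsto_const_nhds (x := a)).sub hu
      rw [sub_self] at this
      simpa using this.norm
    have h2 : Tendsto (fun n => ‖b - x n‖) atTop (𝓝 0) := by
      have := (tendsto_const_nhds (x := b)).sub hx
      rw [sub_self] at this
      simpa using this.norm
    have h3 : Tendsto (fun n => ‖u n‖) atTop (𝓝 ‖a‖) := hu.norm
    have := ((h1.mul_const ‖b‖).add (h3.mul h2)).const_mul |C|
    simpa using this
  filter_upwards [(tendsto_order.1 hlim).2 ε hε] with n hn z hz
  rw [dist_eq_norm]
  calc ‖⟪a, W z b⟫_ℂ - ⟪u n, W z (x n)⟫_ℂ‖ ≤ C * (‖a - u n‖ * ‖b‖ + ‖u n‖ * ‖b - x n‖) :=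
        norm_inner_apply_sub_inner_apply_le (W z) (hW z hz) a b (u n) (x n)
    _ ≤ |C| * (‖a - u n‖ * ‖b‖ + ‖u n‖ * ‖b - x n‖) := by gcongr; exact le_abs_self C
    _ < ε := hn

/-- **Weak continuity from dense sets of vectors**: for a family of operators bounded by `C` on
`s`, continuity on `s` of the matrix coefficients `z ↦ ⟪u, W z x⟫` for `u`, `x` in dense sets
implies it for all vectors. [folklore] -/
theorem continuousOn_inner_of_dense {W : ℂ → H →L[ℂ] H} {s : Set ℂ} {C : ℝ}
    (hW : ∀ z ∈ s, ‖W z‖ ≤ C) {Su Sx : Set H} (hSu : Dense Su) (hSx : Dense Sx)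
    (h : ∀ u ∈ Su, ∀ x ∈ Sx, ContinuousOn (fun z => ⟪u, W z x⟫_ℂ) s) (a b : H) :
    ContinuousOn (fun z => ⟪a, W z b⟫_ℂ) s := by
  obtain ⟨u, hu, hua⟩ := mem_closure_iff_seq_limit.1 (hSu.closure_eq ▸ mem_univ a : a ∈ closure Su)
  obtain ⟨x, hx, hxb⟩ := mem_closure_iff_seq_limit.1 (hSx.closure_eq ▸ mem_univ b : b ∈ closure Sx)
  exact (tendstoUniformlyOn_inner_apply hW hua hxb).continuousOn
    (Eventually.of_forall fun n => h (u n) (hu n) (x n) (hx n)).frequently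

/-- **Weak holomorphy from dense sets of vectors**: for a family of operators bounded by `C` on an
open `s`, holomorphy on `s` of `z ↦ ⟪u, W z x⟫` for `u`, `x` in dense sets implies it for all
vectors (locally uniform limits of holomorphic functions). [folklore] -/
theorem differentiableOn_inner_of_dense [CompleteSpace H] {W : ℂ → H →L[ℂ] H} {s : Set ℂ} {C : ℝ}
    (hs : IsOpen s) (hW : ∀ z ∈ s, ‖W z‖ ≤ C) {Su Sx : Set H} (hSu : Dense Su) (hSx : Dense Sx)
    (h : ∀ u ∈ Su, ∀ x ∈ Sx, DifferentiableOn ℂ (fun z => ⟪u, W z x⟫_ℂ) s) (a b : H) :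
    DifferentiableOn ℂ (fun z => ⟪a, W z b⟫_ℂ) s := by
  obtain ⟨u, hu, hua⟩ := mem_closure_iff_seq_limit.1 (hSu.closure_eq ▸ mem_univ a : a ∈ closure Su)
  obtain ⟨x, hx, hxb⟩ := mem_closure_iff_seq_limit.1 (hSx.closure_eq ▸ mem_univ b : b ∈ closure Sx)
  exact (tendstoUniformlyOn_inner_apply hW hua hxb).tendstoLocallyUniformlyOn.differentiableOn
    (Eventually.of_forall fun n => h (u n) (hu n) (x n) (hx n)) hs

end Dense

/-! ## Weak holomorphy implies norm holomorphy -/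

section WeakToNorm

variable {H : Type*} [NormedAddCommGroup H] [InnerProductSpace ℂ H] [CompleteSpace H]

omit [CompleteSpace H] in
/-- The norm of a vector is controlled by its inner products: if `|⟪a, v⟫| ≤ R ‖a‖` for all `a`
then `‖v‖ ≤ R`. [folklore] -/
theorem norm_le_of_forall_norm_inner_le {v : H} {R : ℝ} (hR : 0 ≤ R)
    (h : ∀ a : H, ‖⟪a, v⟫_ℂ‖ ≤ R * ‖a‖) : ‖v‖ ≤ R := by
  by_cases hv : v = 0
  · rw [hv, norm_zero]; exact hR
  have hpos : 0 < ‖v‖ := norm_pos_iff.2 hv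
  have h1 : ‖v‖ ^ 2 ≤ R * ‖v‖ := by
    have := h v
    rw [inner_self_eq_norm_sq_to_K, norm_pow, RCLike.norm_ofReal, abs_norm] at this
    exact this
  nlinarith

/-- **Weakly holomorphic bounded operator families are norm-holomorphic** (Dunford; Reed–Simon I,
Thm. VI.4, Hilbert space case): if `‖W z‖ ≤ C` on an open set `s` and every matrix coefficient
`z ↦ ⟪a, W z b⟫` is holomorphic on `s`, then `W : ℂ → (H →L[ℂ] H)` is holomorphic on `s`.
[cite: ReedSimonI1980, Thm. VI.4] -/
theorem differentiableOn_of_forall_differentiableOn_inner {W : ℂ → H →L[ℂ] H} {s : Set ℂ} {C : ℝ}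
    (hs : IsOpen s) (hW : ∀ z ∈ s, ‖W z‖ ≤ C)
    (h : ∀ a b : H, DifferentiableOn ℂ (fun z => ⟪a, W z b⟫_ℂ) s) : DifferentiableOn ℂ W s := by
  intro z₀ hz₀
  obtain ⟨r, hr, hball⟩ := Metric.isOpen_iff.1 hs z₀ hz₀
  have hC : 0 ≤ C := (norm_nonneg _).trans (hW z₀ hz₀)
  -- the matrix coefficients and their bounds on the ball
  set φ : H → H → ℂ → ℂ := fun a b z => ⟪a, W z b⟫_ℂ with hφ
  have hφd : ∀ a b, DifferentiableOn ℂ (φ a b) (ball z₀ r) := fun a b => (h a b).mono hball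
  have hφM : ∀ a b, ∀ z ∈ ball z₀ r, ‖φ a b z‖ ≤ C * ‖a‖ * ‖b‖ := by
    intro a b z hz
    calc ‖⟪a, W z b⟫_ℂ‖ ≤ ‖a‖ * ‖W z b‖ := norm_inner_le_norm _ _
      _ ≤ ‖a‖ * (C * ‖b‖) := by gcongr; exact (W z).le_of_opNorm_le (hW z (hball hz)) b
      _ = C * ‖a‖ * ‖b‖ := by ring
  -- the derivative form `S a b = (d/dz) ⟪a, W z b⟫ |_{z₀}`
  set S : H → H → ℂ := fun a b => deriv (φ a b) z₀ with hS
  have hda : ∀ a b, DifferentiableAt ℂ (φ a b) z₀ := fun a b =>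
    (hφd a b).differentiableAt (isOpen_ball.mem_nhds (mem_ball_self hr))
  have hSf : IsSesqForm S := by
    refine ⟨fun a a' b => ?_, fun c a b => ?_, fun a b b' => ?_, fun c a b => ?_⟩
    · have : φ (a + a') b = φ a b + φ a' b := by funext z; simp [hφ, inner_add_left]
      simp only [hS, this]
      exact deriv_add (hda a b) (hda a' b)
    · have : φ (c • a) b = fun z => conj c * φ a b z := by funext z; simp [hφ, inner_smul_left]
      simp only [hS, this]
      exact deriv_const_mul _ (hda a b)
    · have : φ a (b + b') = φ a b + φ a b' := by funext z; simp [hφ, inner_add_right]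
      simp only [hS, this]
      exact deriv_add (hda a b) (hda a b')
    · have : φ a (c • b) = fun z => c * φ a b z := by funext z; simp [hφ, inner_smul_right]
      simp only [hS, this]
      exact deriv_const_mul _ (hda a b)
  have hSb : ∀ a b, ‖S a b‖ ≤ 2 * C / r * ‖a‖ * ‖b‖ := by
    intro a b
    have := norm_deriv_le_of_forall_mem_ball hr (hφd a b) (hφM a b) (mem_ball_self (by positivity))
    calc ‖S a b‖ ≤ 2 * (C * ‖a‖ * ‖b‖) / r := this
      _ = 2 * C / r * ‖a‖ * ‖b‖ := by ring
  set A : H →L[ℂ] H := hSf.operator hSb with hA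
  have hAinner : ∀ a b, ⟪a, A b⟫_ℂ = S a b := hSf.inner_operator hSb
  -- the quadratic remainder estimate, uniformly in the vectors
  have hrem : ∀ z ∈ ball z₀ (r / 4), ‖W z - W z₀ - (z - z₀) • A‖ ≤ 8 * C / r ^ 2 * ‖z - z₀‖ ^ 2 := by
    intro z hz
    refine ContinuousLinearMap.opNorm_le_bound _ (by positivity) fun b => ?_
    refine norm_le_of_forall_norm_inner_le (by positivity) fun a => ?_
    have key := norm_sub_sub_mul_deriv_le hr (hφd a b) (hφM a b) hz
    have heq : ⟪a, (W z - W z₀ - (z - z₀) • A) b⟫_ℂ =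
        φ a b z - φ a b z₀ - (z - z₀) * deriv (φ a b) z₀ := by
      simp only [hφ, hS, FunLike.coe_sub, FunLike.coe_smul, Pi.sub_apply,
        Pi.smul_apply, inner_sub_right, inner_smul_right, hAinner]
    rw [heq]
    calc ‖φ a b z - φ a b z₀ - (z - z₀) * deriv (φ a b) z₀‖
        ≤ 8 * (C * ‖a‖ * ‖b‖) / r ^ 2 * ‖z - z₀‖ ^ 2 := key
      _ = 8 * C / r ^ 2 * ‖z - z₀‖ ^ 2 * ‖b‖ * ‖a‖ := by ring
  -- hence `W` has derivative `A` at `z₀`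
  have hderiv : HasDerivAt W A z₀ := by
    rw [hasDerivAt_iff_isLittleO_nhds_zero]
    refine Asymptotics.IsLittleO.of_bound fun ε hε => ?_
    have hδ : 0 < min (r / 4) (ε / (8 * C / r ^ 2 + 1)) := lt_min (by positivity) (by positivity)
    filter_upwards [Metric.ball_mem_nhds (0 : ℂ) hδ] with k hk
    rw [mem_ball, dist_zero_right, lt_min_iff] at hk
    have hz : z₀ + k ∈ ball z₀ (r / 4) := by
      rw [mem_ball, dist_eq_norm, add_sub_cancel_left]; exact hk.1
    have h1 := hrem (z₀ + k) hz
    rw [add_sub_cancel_left] at h1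
    calc ‖W (z₀ + k) - W z₀ - k • A‖ ≤ 8 * C / r ^ 2 * ‖k‖ ^ 2 := h1
      _ = (8 * C / r ^ 2 * ‖k‖) * ‖k‖ := by ring
      _ ≤ ε * ‖k‖ := by
          gcongr
          have h2 : ‖k‖ < ε / (8 * C / r ^ 2 + 1) := hk.2
          have h3 : 0 < 8 * C / r ^ 2 + 1 := by positivity
          calc 8 * C / r ^ 2 * ‖k‖ ≤ (8 * C / r ^ 2 + 1) * ‖k‖ := by gcongr; linarith
            _ ≤ (8 * C / r ^ 2 + 1) * (ε / (8 * C / r ^ 2 + 1)) := by gcongr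
            _ = ε := by field_simp
  exact hderiv.differentiableAt.differentiableWithinAt

end WeakToNorm

end Literature.Analysis.OperatorTheory
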